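import Literature.Combinatorics.Additive.TripleProductProperty
import Summits.MatrixMultiplication.MatrixMultiplication.Theorems.SnSubsetDichotomyThresholdSubsetTriplesPairFactorisation

/-!
# `SnSubsetDichotomy.ThresholdSubsetTriples`, line `interleaved-subsignature-ascent` — stub `stub_ownerPairNoThird`

Registered stub `stub_ownerPairNoThird` of crux `stmt-MatrixMultiplication-10882` (census c3a, negative design
rule): an EXACTLY factorising chain pair admits no third class.  For every level set `L`, the owner chain classes
`S_A = subsig (ownerSystem L)` and `S_B = subsig (ownerSystem Lᶜ)` factorise `S_n` exactly
(`stub_pairFactorisation`, file `SnSubsetDichotomyThresholdSubsetTriplesPairFactorisation`): every permutation is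
`a⁻¹ b` with `a ∈ S_A`, `b ∈ S_B`.  Hence the right quotient sets satisfy `Q(S_A) Q(S_B) = S_n`, and a third class
`U` with the triple product property (`Literature.Combinatorics.Additive.TripleProductProperty`, Cohn–Umans 2003,
Def. 2.1) has at most one element: for `u, u' ∈ U` factor `s₀⁻¹ (u' u⁻¹) t₀ = s'⁻¹ t` (with `(s₀, t₀)` any pair,
e.g. the one factorising `1`); then `s₀ s'⁻¹ · t t₀⁻¹ · u u'⁻¹ = 1`, so the TPP forces `u = u'`.

Mathlib API used: `Finset.card_le_one`, `group`.
-/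

-- `Summit.<Summit>.<Problem>` is the tree's mandated summit-side namespace; for this single-conjunct summit the
-- two components coincide, so the file silences `dupNamespace` (same as the files it imports).
set_option linter.dupNamespace false
set_option autoImplicit false

namespace Summit.MatrixMultiplication.MatrixMultiplication.Theorems.ThresholdSubsetTriples

open Literature.Combinatorics.Additive

/-- Surjectivity of a pair map `(a, b) ↦ a⁻¹ b : S × T → G` leaves no room for a third TPP class: if every
group element is `a⁻¹ b` with `a ∈ S`, `b ∈ T`, then any `U` with `TripleProductProperty S T U` has at most one
element. [folklore; immediate from Cohn–Umans 2003, Def. 2.1] -/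
theorem card_le_one_of_tpp_of_pair_surjective {G : Type*} [Group G] {S T U : Finset G}
    (hsurj : ∀ σ : G, ∃ a ∈ S, ∃ b ∈ T, a⁻¹ * b = σ) (hT : TripleProductProperty S T U) :
    U.card ≤ 1 := by
  rw [Finset.card_le_one]
  intro u hu u' hu'
  obtain ⟨s₀, hs₀, t₀, ht₀, -⟩ := hsurj 1
  obtain ⟨s', hs', t, ht, he⟩ := hsurj (s₀⁻¹ * (u' * u⁻¹) * t₀)
  have hrel : s₀ * s'⁻¹ * (t * t₀⁻¹) * (u * u'⁻¹) = 1 := by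
    calc s₀ * s'⁻¹ * (t * t₀⁻¹) * (u * u'⁻¹)
        = s₀ * (s'⁻¹ * t) * t₀⁻¹ * (u * u'⁻¹) := by group
      _ = s₀ * (s₀⁻¹ * (u' * u⁻¹) * t₀) * t₀⁻¹ * (u * u'⁻¹) := by rw [he]
      _ = 1 := by group
  exact (hT s₀ hs₀ s' hs' t ht t₀ ht₀ u hu u' hu' hrel).2.2

/-- **No third class for an exact owner pair (stub `stub_ownerPairNoThird`, census c3a).**  For every level set
`L`, the owner chain classes `subsig (ownerSystem L)` and `subsig (ownerSystem Lᶜ)` factorise `S_n` exactly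
(`stub_pairFactorisation`), so `Q(S_A) Q(S_B) = S_n` and any third class `U` completing them to a triple with the
triple product property has `|U| ≤ 1`: the third class of a TPP chain triple must live in the pair's slack. -/
theorem stub_ownerPairNoThird {n : ℕ} (L : Finset (Fin n)) (U : Finset (Equiv.Perm (Fin n)))
    (hT : TripleProductProperty (subsig (ownerSystem L)) (subsig (ownerSystem Lᶜ)) U) : U.card ≤ 1 := by
  refine card_le_one_of_tpp_of_pair_surjective (fun σ => ?_) hT
  obtain ⟨⟨a, b⟩, ⟨ha, hb, hab⟩, -⟩ := stub_pairFactorisation L σ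
  exact ⟨a, ha, b, hb, hab⟩

end Summit.MatrixMultiplication.MatrixMultiplication.Theorems.ThresholdSubsetTriples
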